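import Summits.Ventures.CertifiedManyBodySolver.Downfold.OneBandBox
import HarnessLib

/-!
# The temperature / field axis of a phase-map cell through the S1/S2 seam

Venture CertifiedManyBodySolver, cell `pub/hubbard-downfold` (W3 of ROUTER.md §9: ONE structure at
the S1/S2 seam), seat hubbard-downfold-mod-1; namespace
`Summit.Ventures.CertifiedManyBodySolver.Downfold`. Everything here is PROVED; pure real-interval
reasoning, no operator content. HONEST FRAMING: a downfolded box is a systematic modelling claim
(hypothesis `B.Mem p`); the certified content is S2's word about the unit (`t ≡ 1`) model.

The D-0098 phase map of a material is a table over `T × P × H` cells. Pressure enters through the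
box itself (one box per `P`). Temperature and field are PHYSICAL energies `k_B T`, `μ_B B` (in the
unit of `t_eV`), while a `T > 0` word certified by S2 is a word about the unit model at an inverse
temperature `β̃ = t / (k_B T)` and reduced field `h̃ = h / t` — the kernel identity behind this is
unc-2's `gibbsState_hubbardTorusTT'_grandCanonical_eq_unit`
(`Literature/MathematicalPhysics/QuantumLattice/HubbardTTPrimeScaleHomogeneity.lean` §4): the Gibbs
state of `H(t, t', U) − μN − hS^z` at `β` IS that of `H(1, t'/t, U/t) − (μ/t)N − (h/t)S^z` at `βt`.
This file is the interval bookkeeping that reads such words on a cell, and nothing else: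

* `NonemptyInterval.divPos_ends_of_nonneg` — for a nonnegative numerator `[a, b]` and a positive
  denominator `[c, d]` the quotient interval `divPos` (IntervalCalculus §3, Moore product with the
  reciprocal) has the closed form `[a/d, b/c]`; `div_mem_Icc_ends` is the real membership form.
* `holdsOn_oneBand_of_cell_invTemp` — THE T-AXIS SEAM: a unit-model word `W₁ s u n β̃` proved on the
  product cell `eS.encl × eU.encl × eN.encl × (eT.encl / Θ)` (Θ = the temperature cell `[kT₁, kT₂]`
  in the unit of `t_eV`, `0 < kT₁`) holds, for every `kT ∈ Θ`, on the box as
  `p ↦ W₁ (p tp/t) (p U/t) (p n) (p t_eV / kT)`.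
* `holdsOn_oneBand_of_cell_reduced` — the same for an axis entering as `x / t` (reduced temperature
  `k_B T / t`, reduced Zeeman field `h / t`, reduced chemical potential): `x / p t_eV ∈ X / eT.encl`
  (needs `0 < eT.encl.fst`, the positive scale); `holdsOn_oneBand_of_cell_invTemp_reduced` carries a
  temperature cell and a field cell at once (the `T × H` face of the map at fixed `P`).
* MONOTONE WORDS: `holdsOn_oneBand_of_cell_invTemp_of_monotone` — if the word is upward-closed in
  `β̃` (once true, true at every larger `β̃`; NO claim that any particular certificate is) it suffices
  to certify it at the single point `β̃₀ = t₁ / kT₂`; `…_of_antitone` dually at `t₂ / kT₁`.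
* THRESHOLD SIDE CONDITIONS bind at corners and are decidable on the box's rationals:
  `forall_le_div_iff` (`θ ≤ t/kT` on the whole cell ⇔ `θ ≤ t₁/kT₂`) and `forall_div_le_iff`
  (`t/kT ≤ θ` on the whole cell ⇔ `t₂/kT₁ ≤ θ`) — unc-2's TRANSPORT-TABLE §D.5 remark made exact.
-/

namespace NonemptyInterval

variable {K : Type*} [Field K] [LinearOrder K] [IsStrictOrderedRing K]

/-- **Closed form of the quotient interval for a nonnegative numerator**: if `0 ≤ a` and `0 < c`
then `[a, b] / [c, d] = [a/d, b/c]` (the Moore product with `[d⁻¹, c⁻¹]` attains its extremes at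
these two corners). [cite: Moore1966, §2.2] -/
theorem divPos_ends_of_nonneg {I T : NonemptyInterval ℚ} (hT : 0 < T.fst) (hI : 0 ≤ I.fst) :
    (I.divPos T hT).fst = I.fst / T.snd ∧ (I.divPos T hT).snd = I.snd / T.fst := by
  have hd : 0 < T.snd := hT.trans_le T.fst_le_snd
  have hinv : T.snd⁻¹ ≤ T.fst⁻¹ := inv_anti₀ hT T.fst_le_snd
  have hb : 0 ≤ I.snd := hI.trans I.fst_le_snd
  have h1 : I.fst * T.snd⁻¹ ≤ I.fst * T.fst⁻¹ := mul_le_mul_of_nonneg_left hinv hI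
  have h2 : I.fst * T.snd⁻¹ ≤ I.snd * T.snd⁻¹ :=
    mul_le_mul_of_nonneg_right I.fst_le_snd (inv_nonneg.2 hd.le)
  have h3 : I.snd * T.snd⁻¹ ≤ I.snd * T.fst⁻¹ := mul_le_mul_of_nonneg_left hinv hb
  have h4 : I.fst * T.fst⁻¹ ≤ I.snd * T.fst⁻¹ :=
    mul_le_mul_of_nonneg_right I.fst_le_snd (inv_nonneg.2 hT.le)
  simp only [divPos, invPos, fst_mooreMul, snd_mooreMul, div_eq_mul_inv]
  refine ⟨le_antisymm ((min_le_left _ _).trans (min_le_left _ _)) ?_,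
    le_antisymm ?_ ((le_max_right _ _).trans' (le_max_right _ _))⟩
  · exact le_min (le_min le_rfl h1) (le_min h2 (h2.trans h3))
  · exact max_le (max_le (h1.trans h4) h4) (max_le h3 le_rfl)

/-- Real form: `x ∈ [a, b]`, `s ∈ [c, d]`, `0 ≤ a`, `0 < c` ⇒ `x / s ∈ Set.Icc (a/d) (b/c)` (casts
to the field `K`). [cite: Moore1966, Theorem 3.1] -/
theorem div_mem_Icc_ends {I T : NonemptyInterval ℚ} (hT : 0 < T.fst) (hI : 0 ≤ I.fst) {x s : K}
    (hx : x ∈ I.ratCast K) (hs : s ∈ T.ratCast K) :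
    x / s ∈ Set.Icc (((I.fst / T.snd : ℚ)) : K) (((I.snd / T.fst : ℚ)) : K) := by
  have h := mem_ratCast_iff.1 (div_mem_divPos hT hx hs)
  obtain ⟨h1, h2⟩ := divPos_ends_of_nonneg hT hI
  rw [h1] at h
  rw [h2] at h
  exact ⟨h.1, h.2⟩

end NonemptyInterval

namespace Summit.Ventures.CertifiedManyBodySolver.Downfold

open NonemptyInterval

/-- **The T-axis seam (inverse temperature of the unit model).** Let the one-band box `B` carry
entries `eS, eU, eN, eT` for `tp/t`, `U/t`, `n`, `t_eV`, and let `Θ = [kT₁, kT₂]` (`0 < kT₁`, same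
energy unit as `t_eV`) be a temperature cell of the phase map. If the unit-model word `W₁ s u n β̃`
holds for all `(s, u, n)` in the product cell and all `β̃ ∈ eT.encl / Θ` (`divPos`), then for every
`kT ∈ Θ` the word `p ↦ W₁ (p tp/t) (p U/t) (p n) (p t_eV / kT)` holds on `B`. [folklore] -/
theorem holdsOn_oneBand_of_cell_invTemp {B : OneBandBox} {eS eU eN eT : Entry}
    (hS : B .tpOverT = some eS) (hU : B .UOverT = some eU) (hN : B .filling = some eN)
    (hT : B .tEV = some eT) {Θ : NonemptyInterval ℚ} (hΘ : 0 < Θ.fst)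
    {W₁ : ℝ → ℝ → ℝ → ℝ → Prop}
    (hW : ∀ s u n β : ℝ, s ∈ eS.encl.ratCast ℝ → u ∈ eU.encl.ratCast ℝ → n ∈ eN.encl.ratCast ℝ →
      β ∈ (eT.encl.divPos Θ hΘ).ratCast ℝ → W₁ s u n β)
    {kT : ℝ} (hk : kT ∈ Θ.ratCast ℝ) :
    HoldsOn (fun p : OneBandCoord → ℝ => W₁ (p .tpOverT) (p .UOverT) (p .filling) (p .tEV / kT)) B :=
  fun _ hp => hW _ _ _ _ (hp _ _ hS) (hp _ _ hU) (hp _ _ hN) (div_mem_divPos hΘ (hp _ _ hT) hk)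

/-- **Reduced-axis seam (`x / t`).** Same box; a physical energy-like axis value `x` (temperature
`k_B T`, Zeeman field `μ_B B`, chemical potential) ranging over a rational cell `X` enters the unit
model as `x / t`. With a positive scale (`0 < eT.encl.fst`), a unit-model word `W₁ s u n (x/t)`
proved for all `(s, u, n)` in the product cell and all reduced values in `X / eT.encl` holds, for
every `x ∈ X`, on `B` as `p ↦ W₁ (p tp/t) (p U/t) (p n) (x / p t_eV)`. [folklore] -/
theorem holdsOn_oneBand_of_cell_reduced {B : OneBandBox} {eS eU eN eT : Entry}
    (hS : B .tpOverT = some eS) (hU : B .UOverT = some eU) (hN : B .filling = some eN)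
    (hT : B .tEV = some eT) (hT0 : 0 < eT.encl.fst) {X : NonemptyInterval ℚ}
    {W₁ : ℝ → ℝ → ℝ → ℝ → Prop}
    (hW : ∀ s u n r : ℝ, s ∈ eS.encl.ratCast ℝ → u ∈ eU.encl.ratCast ℝ → n ∈ eN.encl.ratCast ℝ →
      r ∈ (X.divPos eT.encl hT0).ratCast ℝ → W₁ s u n r)
    {x : ℝ} (hx : x ∈ X.ratCast ℝ) :
    HoldsOn (fun p : OneBandCoord → ℝ => W₁ (p .tpOverT) (p .UOverT) (p .filling) (x / p .tEV)) B :=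
  fun _ hp => hW _ _ _ _ (hp _ _ hS) (hp _ _ hU) (hp _ _ hN) (div_mem_divPos hT0 hx (hp _ _ hT))

/-- **The `T × H` face of a phase-map cell at fixed `P`.** Temperature cell `Θ` (`0 < Θ.fst`) read as
inverse temperature `t / kT ∈ eT.encl / Θ`, field cell `Hc` read as reduced field
`h / t ∈ Hc / eT.encl` (`0 < eT.encl.fst`); a unit-model word in both holds on the box for every
`(kT, h) ∈ Θ × Hc`. [folklore] -/
theorem holdsOn_oneBand_of_cell_invTemp_reduced {B : OneBandBox} {eS eU eN eT : Entry}
    (hS : B .tpOverT = some eS) (hU : B .UOverT = some eU) (hN : B .filling = some eN)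
    (hT : B .tEV = some eT) (hT0 : 0 < eT.encl.fst) {Θ Hc : NonemptyInterval ℚ} (hΘ : 0 < Θ.fst)
    {W₁ : ℝ → ℝ → ℝ → ℝ → ℝ → Prop}
    (hW : ∀ s u n β r : ℝ, s ∈ eS.encl.ratCast ℝ → u ∈ eU.encl.ratCast ℝ → n ∈ eN.encl.ratCast ℝ →
      β ∈ (eT.encl.divPos Θ hΘ).ratCast ℝ → r ∈ (Hc.divPos eT.encl hT0).ratCast ℝ → W₁ s u n β r)
    {kT h : ℝ} (hk : kT ∈ Θ.ratCast ℝ) (hh : h ∈ Hc.ratCast ℝ) :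
    HoldsOn (fun p : OneBandCoord → ℝ =>
      W₁ (p .tpOverT) (p .UOverT) (p .filling) (p .tEV / kT) (h / p .tEV)) B :=
  fun _ hp => hW _ _ _ _ _ (hp _ _ hS) (hp _ _ hU) (hp _ _ hN)
    (div_mem_divPos hΘ (hp _ _ hT) hk) (div_mem_divPos hT0 hh (hp _ _ hT))

/-- Corner bound below: on the cell `t ∈ [t₁, t₂]`, `kT ∈ [kT₁, kT₂]` with `0 ≤ t₁`, `0 < kT₁`, the
unit inverse temperature satisfies `t₁ / kT₂ ≤ t / kT`. [folklore] -/
theorem ends_div_le_div {T Θ : NonemptyInterval ℚ} (hΘ : 0 < Θ.fst) (hT0 : 0 ≤ T.fst) {t kT : ℝ}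
    (ht : t ∈ T.ratCast ℝ) (hk : kT ∈ Θ.ratCast ℝ) : ((T.fst / Θ.snd : ℚ) : ℝ) ≤ t / kT :=
  (div_mem_Icc_ends hΘ hT0 ht hk).1

/-- Corner bound above: on the same cell, `t / kT ≤ t₂ / kT₁`. [folklore] -/
theorem div_le_ends_div {T Θ : NonemptyInterval ℚ} (hΘ : 0 < Θ.fst) (hT0 : 0 ≤ T.fst) {t kT : ℝ}
    (ht : t ∈ T.ratCast ℝ) (hk : kT ∈ Θ.ratCast ℝ) : t / kT ≤ ((T.snd / Θ.fst : ℚ) : ℝ) :=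
  (div_mem_Icc_ends hΘ hT0 ht hk).2

/-- **Monotone (upward-closed in `β̃`) words need one point.** If, on the product cell, the word is
upward-closed in the inverse temperature (`W₁ s u n β → β ≤ β' → W₁ s u n β'`) and holds at the
cell's smallest inverse temperature `β̃₀ = t₁ / kT₂` (`0 ≤ t₁ = eT.encl.fst`), then it holds on the
box for every `kT ∈ Θ`. NO claim that any particular certificate is monotone — that is S2's to
state. [folklore] -/
theorem holdsOn_oneBand_of_cell_invTemp_of_monotone {B : OneBandBox} {eS eU eN eT : Entry}
    (hS : B .tpOverT = some eS) (hU : B .UOverT = some eU) (hN : B .filling = some eN)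
    (hT : B .tEV = some eT) (hT0 : 0 ≤ eT.encl.fst) {Θ : NonemptyInterval ℚ} (hΘ : 0 < Θ.fst)
    {W₁ : ℝ → ℝ → ℝ → ℝ → Prop}
    (hmono : ∀ s u n β β' : ℝ, s ∈ eS.encl.ratCast ℝ → u ∈ eU.encl.ratCast ℝ →
      n ∈ eN.encl.ratCast ℝ → β ≤ β' → W₁ s u n β → W₁ s u n β')
    (h0 : ∀ s u n : ℝ, s ∈ eS.encl.ratCast ℝ → u ∈ eU.encl.ratCast ℝ → n ∈ eN.encl.ratCast ℝ →
      W₁ s u n (((eT.encl.fst / Θ.snd : ℚ)) : ℝ))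
    {kT : ℝ} (hk : kT ∈ Θ.ratCast ℝ) :
    HoldsOn (fun p : OneBandCoord → ℝ => W₁ (p .tpOverT) (p .UOverT) (p .filling) (p .tEV / kT)) B :=
  fun _ hp => hmono _ _ _ _ _ (hp _ _ hS) (hp _ _ hU) (hp _ _ hN)
    (ends_div_le_div hΘ hT0 (hp _ _ hT) hk) (h0 _ _ _ (hp _ _ hS) (hp _ _ hU) (hp _ _ hN))

/-- **Antitone (downward-closed in `β̃`) words need one point**: certify at the cell's largest
inverse temperature `t₂ / kT₁`. [folklore] -/
theorem holdsOn_oneBand_of_cell_invTemp_of_antitone {B : OneBandBox} {eS eU eN eT : Entry}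
    (hS : B .tpOverT = some eS) (hU : B .UOverT = some eU) (hN : B .filling = some eN)
    (hT : B .tEV = some eT) (hT0 : 0 ≤ eT.encl.fst) {Θ : NonemptyInterval ℚ} (hΘ : 0 < Θ.fst)
    {W₁ : ℝ → ℝ → ℝ → ℝ → Prop}
    (hanti : ∀ s u n β β' : ℝ, s ∈ eS.encl.ratCast ℝ → u ∈ eU.encl.ratCast ℝ →
      n ∈ eN.encl.ratCast ℝ → β' ≤ β → W₁ s u n β → W₁ s u n β')
    (h0 : ∀ s u n : ℝ, s ∈ eS.encl.ratCast ℝ → u ∈ eU.encl.ratCast ℝ → n ∈ eN.encl.ratCast ℝ →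
      W₁ s u n (((eT.encl.snd / Θ.fst : ℚ)) : ℝ))
    {kT : ℝ} (hk : kT ∈ Θ.ratCast ℝ) :
    HoldsOn (fun p : OneBandCoord → ℝ => W₁ (p .tpOverT) (p .UOverT) (p .filling) (p .tEV / kT)) B :=
  fun _ hp => hanti _ _ _ _ _ (hp _ _ hS) (hp _ _ hU) (hp _ _ hN)
    (div_le_ends_div hΘ hT0 (hp _ _ hT) hk) (h0 _ _ _ (hp _ _ hS) (hp _ _ hU) (hp _ _ hN))

/-- **«`β̃ ≥ θ`» side conditions bind at the corner `(t₁, kT₂)` and are decidable there**: for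
`0 ≤ t₁` and `0 < kT₁`, `θ ≤ t / kT` for every `(t, kT)` of the cell iff `θ ≤ t₁ / kT₂`. [folklore] -/
theorem forall_le_div_iff {T Θ : NonemptyInterval ℚ} (hΘ : 0 < Θ.fst) (hT0 : 0 ≤ T.fst) {θ : ℚ} :
    (∀ t kT : ℝ, t ∈ T.ratCast ℝ → kT ∈ Θ.ratCast ℝ → (θ : ℝ) ≤ t / kT) ↔ θ ≤ T.fst / Θ.snd := by
  constructor
  · intro h
    have ht : ((T.fst : ℚ) : ℝ) ∈ T.ratCast ℝ := mem_ratCast_iff.2 ⟨le_rfl, by exact_mod_cast T.fst_le_snd⟩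
    have hk : ((Θ.snd : ℚ) : ℝ) ∈ Θ.ratCast ℝ := mem_ratCast_iff.2 ⟨by exact_mod_cast Θ.fst_le_snd, le_rfl⟩
    have := h _ _ ht hk
    exact_mod_cast this
  · intro h t kT ht hk
    exact le_trans (by exact_mod_cast h) (ends_div_le_div hΘ hT0 ht hk)

/-- **«`β̃ ≤ θ`» side conditions bind at the corner `(t₂, kT₁)`**: `t / kT ≤ θ` for every `(t, kT)`
of the cell iff `t₂ / kT₁ ≤ θ`. [folklore] -/
theorem forall_div_le_iff {T Θ : NonemptyInterval ℚ} (hΘ : 0 < Θ.fst) (hT0 : 0 ≤ T.fst) {θ : ℚ} :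
    (∀ t kT : ℝ, t ∈ T.ratCast ℝ → kT ∈ Θ.ratCast ℝ → t / kT ≤ (θ : ℝ)) ↔ T.snd / Θ.fst ≤ θ := by
  constructor
  · intro h
    have ht : ((T.snd : ℚ) : ℝ) ∈ T.ratCast ℝ := mem_ratCast_iff.2 ⟨by exact_mod_cast T.fst_le_snd, le_rfl⟩
    have hk : ((Θ.fst : ℚ) : ℝ) ∈ Θ.ratCast ℝ := mem_ratCast_iff.2 ⟨le_rfl, by exact_mod_cast Θ.fst_le_snd⟩
    have := h _ _ ht hk
    exact_mod_cast this
  · intro h t kT ht hk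
    exact le_trans (div_le_ends_div hΘ hT0 ht hk) (by exact_mod_cast h)

end Summit.Ventures.CertifiedManyBodySolver.Downfold
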